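import Mathlib.LinearAlgebra.Matrix.NonsingularInverse
import Mathlib.Algebra.Order.Ring.Defs
import Mathlib.Data.Fin.VecNotation
import Mathlib.Data.Int.Cast.Lemmas
import HarnessLib

/-!
# Multidimensional continued fraction algorithms (memoryless, piecewise unimodular)

The linear ("homogeneous") framework for multidimensional continued fraction (MCF)
algorithms of Schweiger [Schweiger2000, Ch. 1], Thuswaldner [Thuswaldner2020, Def. 3.4.3],
Karpenkov [Karpenkov2013, §27.4.1] and Lagarias [Lagarias1993, §2]:
an algorithm in dimension `d` is a family of *pieces* `C_j ⊆ ℝ^{d+1}` (polyhedral cones cut out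
by finitely many integral linear inequalities) together with *unimodular* integer matrices
`A_j ∈ GL_{d+1}(ℤ)`; the (memoryless, Markovian) map sends `v ∈ C_j` to `A_j⁻¹ v`
("`F(x) = M(x)⁻¹ x`", [Thuswaldner2020, Def. 3.4.3]). Iterating from the homogeneous vector
`v₀ = (1, α₁, …, α_d)` of `α ∈ ℝ^d` gives the *orbit* `v_{t+1} = A_{j(t)}⁻¹ v_t`, the *digit
stream* `j(0), j(1), …` and the *convergent matrices* `P_t = A_{j(0)} ⋯ A_{j(t-1)} ∈ GL_{d+1}(ℤ)`,
whose columns `(q, p₁, …, p_d)` are the simultaneous rational approximations produced by the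
algorithm; the fundamental relation is `v₀ = P_t v_t` (`act_convergent_orbit`).

## Main definitions

* `MCFConstraint d`, `MCFConstraint.Holds` — an integral linear constraint (row + strictness flag).
* `MCFAlgorithm d ι` — the data: `mat j` (the partial-quotient matrix `A_j`), `isUnit_det`
  (unimodularity, `det A_j = ±1`), `piece j` (the finite list of constraints cutting out `C_j`).
  "Finitely many pieces" (an *additive* algorithm in the terminology of
  [Thuswaldner2020, Def. 3.4.3]) is the hypothesis `[Finite ι]`, to be added by users; the
  Jacobi–Perron algorithm needs an infinite `ι`.
* `MCFAlgorithm.digit`, `next`, `orbit`, `digitAt`, `digits`, `Terminated`, `OnFace`,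
  `convergent`, `approximant`, `homog` — the dynamics, over any linearly ordered commutative
  ring `K` (so that rational inputs can be iterated exactly in `ℚ`, real ones in `ℝ`).
* `MCFAlgorithm.PiecesDisjoint`, `MCFAlgorithm.Covers` — partition properties of the pieces.
* `MCFAlgorithm.transducerState`, `transducerOutput`, `EmitsEntry` — a deterministic
  finite-state transducer (Mealy machine, given by an initial state and a step function
  `σ → ι → σ × List Γ`, e.g. the fields `init`, `step` of
  `Literature.Computability.Complexity.FST`) reading the digit stream and emitting, at each
  step, a list of positions of the current convergent matrix; `EmitsEntry` is the set of
  integers so named. This is the glue wanted by route PneNP/DirichletPigeons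
  (item `FiniteMemoryMcfRung`).

Classical instances (Gauss, Farey, Jacobi–Perron, sorted `p`-subtractive = Brun / Selmer,
unsorted Brun / Selmer) are in `MCFAlgorithmExamples.lean`; best simultaneous approximation
denominators (Lagarias) are in `BestSimultaneousApproximation.lean`.

## Design choices

* Determinism on boundaries. The sources define the map only almost everywhere (the pieces
  form a partition up to a null set, [Thuswaldner2020, Def. 3.4.3]) or use half-open pieces
  given by floor functions / sorting with a tie-break ([Karpenkov2013, §27.4.2]). Here a piece
  is a finite intersection of closed *or open* integral half-spaces (the `Bool` flag of a
  constraint), so genuine partitions can be written down, and `digit v = some j` iff `j` is the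
  *unique* piece containing `v`; if no piece or several pieces contain `v` then `digit v = none`
  and the orbit stops moving (`Terminated`, monotone in time). The termination domain of an
  algorithm ([Karpenkov2013, §27.4.1 (iv)], e.g. `x₁ = 0` for Jacobi–Perron) is thus encoded by
  leaving it uncovered; `OnFace` records the weaker event "some coordinate vanished".
* Indexing of convergents: `convergent v₀ 0 = 1` and `convergent v₀ (t+1) = convergent v₀ t * A_{j(t)}`,
  so `convergent v₀ t = A_{j(0)} ⋯ A_{j(t-1)}` (the matrix called `P_{t-1}` in [Lagarias1993]).
* Coordinate `0` is the denominator coordinate: `homog α = (1, α)`, and column `k` of a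
  convergent matrix is an integer vector `(q, p₁, …, p_d)` ([Karpenkov2013, Ex. 27.56] writes
  Jacobi–Perron in exactly these coordinates).
* What is NOT here: the projective (linear-fractional) version on the simplex, invariant
  measures and the metric theory [Schweiger2000], convergence exponents [Lagarias1993].

## References

* [Schweiger2000] F. Schweiger, *Multidimensional Continued Fractions*, OUP 2000, Ch. 1 (not held;
  the standard reference for the framework).
* [Thuswaldner2020] J. Thuswaldner, *S-adic sequences*, in: Akiyama–Arnoux (eds.), Substitution and
  Tiling Dynamics, LNM 2273 (2020), Definition 3.4.3 (generalized continued fraction algorithm),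
  Example 3.4.4 (Brun).
* [Karpenkov2013] O. Karpenkov, *Geometry of Continued Fractions*, Springer 2013, §27.4.1 (general
  algorithmic scheme), Examples 27.55–27.60.
* [Lagarias1993] J. C. Lagarias, Monatsh. Math. 115 (1993) 299–328, §2 (not held).
* [Labbe2015] S. Labbé, *3-dimensional continued fraction algorithms cheat sheets*, arXiv:1511.08399,
  §§1–2 ("Matrix Definition": `F(x) = M(x)⁻¹ x`).
-/

namespace Literature.NumberTheory.DiophantineApproximation

open Matrix

/-- An integral linear constraint on vectors `v : Fin (d+1) → K`: an integer row `c` together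
with a strictness flag; `(c, false)` reads `0 ≤ ∑ i, c i * v i` and `(c, true)` reads
`0 < ∑ i, c i * v i`. Finite lists of such constraints cut out the polyhedral pieces of an
MCF algorithm. [folklore] -/
abbrev MCFConstraint (d : ℕ) : Type := (Fin (d + 1) → ℤ) × Bool

namespace MCFConstraint

variable {d : ℕ} {K : Type*} [CommRing K] [LinearOrder K]

/-- The value `∑ i, c i * v i` of the integer row `c` on the vector `v`. [folklore] -/
def eval (c : Fin (d + 1) → ℤ) (v : Fin (d + 1) → K) : K := ∑ i, (c i : K) * v i

/-- Satisfaction of a constraint: `0 ≤ eval c v` (non-strict) or `0 < eval c v` (strict).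
[folklore] -/
def Holds : MCFConstraint d → (Fin (d + 1) → K) → Prop
  | (c, false), v => 0 ≤ eval c v
  | (c, true), v => 0 < eval c v

/-- Unfolding a non-strict constraint. [folklore] -/
@[simp] theorem holds_false_iff (c : Fin (d + 1) → ℤ) (v : Fin (d + 1) → K) :
    Holds (c, false) v ↔ 0 ≤ eval c v := Iff.rfl

/-- Unfolding a strict constraint. [folklore] -/
@[simp] theorem holds_true_iff (c : Fin (d + 1) → ℤ) (v : Fin (d + 1) → K) :
    Holds (c, true) v ↔ 0 < eval c v := Iff.rfl

end MCFConstraint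

/-- A (memoryless, piecewise unimodular) **multidimensional continued fraction algorithm** in
dimension `d` with pieces indexed by `ι` [Thuswaldner2020, Def. 3.4.3], [Karpenkov2013, §27.4.1],
[Schweiger2000, Ch. 1], [Lagarias1993, §2]: for each piece `j`, the partial-quotient matrix
`A_j = mat j ∈ GL_{d+1}(ℤ)` (an integer matrix with `det A_j = ±1`, field `isUnit_det`) and the
polyhedral cone `C_j = {v | every constraint in piece j holds at v}`. The algorithm maps
`v ∈ C_j` to `A_j⁻¹ v` (`MCFAlgorithm.next`). Finitely many pieces = `[Finite ι]`.
[cite: Thuswaldner2020, Definition 3.4.3] -/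
structure MCFAlgorithm (d : ℕ) (ι : Type*) where
  /-- the partial-quotient matrix `A_j` of piece `j` (the orbit moves by `A_j⁻¹`, the convergent
  matrix is multiplied on the right by `A_j`) -/
  mat : ι → Matrix (Fin (d + 1)) (Fin (d + 1)) ℤ
  /-- unimodularity: `det A_j` is a unit of `ℤ`, i.e. `±1` -/
  isUnit_det : ∀ j, IsUnit (mat j).det
  /-- the finite list of integral linear constraints cutting out the piece `C_j` -/
  piece : ι → List (MCFConstraint d)

namespace MCFAlgorithm

variable {d : ℕ} {ι : Type*} (T : MCFAlgorithm d ι)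

section Action

variable {K : Type*} [CommRing K]

/-- The action of an integer matrix on `K`-vectors, `v ↦ A v`. [folklore] -/
def act (A : Matrix (Fin (d + 1)) (Fin (d + 1)) ℤ) (v : Fin (d + 1) → K) : Fin (d + 1) → K :=
  (Int.castRingHom K).mapMatrix A *ᵥ v

/-- Entries of the action: `(A v)_i = ∑ k, A i k * v k`. [folklore] -/
theorem act_apply (A : Matrix (Fin (d + 1)) (Fin (d + 1)) ℤ) (v : Fin (d + 1) → K) (i : Fin (d + 1)) :
    act A v i = ∑ k, (A i k : K) * v k := by
  simp [act, Matrix.mulVec, dotProduct]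

/-- The action is multiplicative. [folklore] -/
theorem act_act (A B : Matrix (Fin (d + 1)) (Fin (d + 1)) ℤ) (v : Fin (d + 1) → K) :
    act A (act B v) = act (A * B) v := by
  simp only [act, Matrix.mulVec_mulVec, map_mul]

/-- The identity acts trivially. [folklore] -/
@[simp] theorem act_one (v : Fin (d + 1) → K) : act (1 : Matrix (Fin (d + 1)) (Fin (d + 1)) ℤ) v = v := by
  simp only [act, map_one, Matrix.one_mulVec]

/-- The homogeneous vector `(1, α₁, …, α_d)` of `α ∈ K^d`, the starting point of the expansion
of `α`. [cite: Karpenkov2013, Example 27.56] -/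
def homog (α : Fin d → K) : Fin (d + 1) → K := Matrix.vecCons 1 α

/-- `homog α 0 = 1`. [folklore] -/
@[simp] theorem homog_zero (α : Fin d → K) : homog α 0 = 1 := rfl

/-- `homog α (i+1) = α i`. [folklore] -/
@[simp] theorem homog_succ (α : Fin d → K) (i : Fin d) : homog α i.succ = α i := by
  simp [homog]

end Action

section Dynamics

variable {K : Type*} [CommRing K] [LinearOrder K]

/-- `v` lies in the piece `C_j`: all constraints of `piece j` hold at `v`. [folklore] -/
def MemPiece (j : ι) (v : Fin (d + 1) → K) : Prop := ∀ c ∈ T.piece j, c.Holds v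

/-- The pieces are pairwise disjoint over `K` (a genuine partition of their union).
[cite: Thuswaldner2020, Definition 3.4.3] -/
def PiecesDisjoint (K : Type*) [CommRing K] [LinearOrder K] : Prop :=
  ∀ (v : Fin (d + 1) → K) (j j' : ι), T.MemPiece j v → T.MemPiece j' v → j = j'

/-- The pieces cover the set `D` (typically the positive cone minus the termination domain).
[cite: Thuswaldner2020, Definition 3.4.3] -/
def Covers (D : Set (Fin (d + 1) → K)) : Prop := ∀ v ∈ D, ∃ j, T.MemPiece j v

open Classical in
/-- The digit of `v`: `some j` if `j` is the unique piece containing `v`, `none` otherwise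
(no piece — the termination domain — or an ambiguous boundary point).
[cite: Karpenkov2013, §27.4.1] -/
noncomputable def digit (v : Fin (d + 1) → K) : Option ι :=
  if h : ∃! j, T.MemPiece j v then some (Classical.choose (ExistsUnique.exists h)) else none

/-- Characterisation of `digit v = some j`. [folklore] -/
theorem digit_eq_some_iff {v : Fin (d + 1) → K} {j : ι} :
    T.digit v = some j ↔ T.MemPiece j v ∧ ∀ j', T.MemPiece j' v → j' = j := by
  unfold digit
  split_ifs with h
  · have hc : T.MemPiece (Classical.choose (ExistsUnique.exists h)) v :=
      Classical.choose_spec (ExistsUnique.exists h)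
    constructor
    · intro hj
      obtain rfl := Option.some.inj hj
      exact ⟨hc, fun j' hj' => h.unique hj' hc⟩
    · rintro ⟨hj, huniq⟩
      exact congrArg some ((huniq _ hc))
  · simp only [false_iff, not_and]
    intro hj huniq
    exact h ⟨j, hj, huniq⟩

/-- Characterisation of `digit v = none`. [folklore] -/
theorem digit_eq_none_iff {v : Fin (d + 1) → K} :
    T.digit v = none ↔ ¬ ∃! j, T.MemPiece j v := by
  unfold digit
  split_ifs with h <;> simp [h]

/-- The selected piece contains the point. [folklore] -/
theorem memPiece_of_digit_eq_some {v : Fin (d + 1) → K} {j : ι} (h : T.digit v = some j) :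
    T.MemPiece j v :=
  ((T.digit_eq_some_iff).1 h).1

/-- For pairwise disjoint pieces the digit is determined by membership. [folklore] -/
theorem digit_eq_some_of_piecesDisjoint (hD : T.PiecesDisjoint K) {v : Fin (d + 1) → K} {j : ι}
    (h : T.MemPiece j v) : T.digit v = some j :=
  (T.digit_eq_some_iff).2 ⟨h, fun j' hj' => hD v j' j hj' h⟩

/-- The inverse matrix `A_j⁻¹` (again integral, by unimodularity): the linear map applied on the
piece `C_j`. [cite: Thuswaldner2020, Definition 3.4.3] -/
noncomputable def inv (j : ι) : Matrix (Fin (d + 1)) (Fin (d + 1)) ℤ := (T.mat j)⁻¹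

/-- `A_j * A_j⁻¹ = 1` over `ℤ`. [folklore] -/
theorem mat_mul_inv (j : ι) : T.mat j * T.inv j = 1 := Matrix.mul_nonsing_inv _ (T.isUnit_det j)

/-- `A_j⁻¹ * A_j = 1` over `ℤ`. [folklore] -/
theorem inv_mul_mat (j : ι) : T.inv j * T.mat j = 1 := Matrix.nonsing_inv_mul _ (T.isUnit_det j)

/-- One step of the algorithm: `v ↦ A_j⁻¹ v` on the piece `C_j`; points without a digit are fixed.
[cite: Thuswaldner2020, Definition 3.4.3] -/
noncomputable def next (v : Fin (d + 1) → K) : Fin (d + 1) → K :=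
  match T.digit v with
  | none => v
  | some j => act (T.inv j) v

/-- The orbit `v_0 = v₀`, `v_{t+1} = next v_t`. [cite: Karpenkov2013, §27.4.1] -/
noncomputable def orbit (v₀ : Fin (d + 1) → K) : ℕ → (Fin (d + 1) → K)
  | 0 => v₀
  | t + 1 => T.next (orbit v₀ t)

/-- The digit `j(t)` read at time `t` (`none` from termination on).
[cite: Karpenkov2013, §27.4.1] -/
noncomputable def digitAt (v₀ : Fin (d + 1) → K) (t : ℕ) : Option ι := T.digit (T.orbit v₀ t)

/-- The finite digit word `j(0) … j(t-1)` read before time `t` (terminated steps contribute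
nothing). [folklore] -/
noncomputable def digits (v₀ : Fin (d + 1) → K) (t : ℕ) : List ι :=
  (List.range t).filterMap (T.digitAt v₀)

/-- The expansion of `v₀` has terminated by time `t`: no (unique) piece contains `v_t`, e.g.
`v_t` lies in the termination domain of the algorithm. [cite: Karpenkov2013, §27.4.1] -/
def Terminated (v₀ : Fin (d + 1) → K) (t : ℕ) : Prop := T.digitAt v₀ t = none

/-- The weaker event "`v_t` lies on a coordinate face" (some coordinate vanishes), which is how
expansions of rational vectors end [cite: Karpenkov2013, Remark 27.57]. -/
def OnFace (v₀ : Fin (d + 1) → K) (t : ℕ) : Prop := ∃ i, T.orbit v₀ t i = 0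

/-- The convergent matrices `P_0 = 1`, `P_{t+1} = P_t * A_{j(t)}` (unchanged after termination),
i.e. `P_t = A_{j(0)} ⋯ A_{j(t-1)}`. [cite: Lagarias1993, §2] -/
noncomputable def convergent (v₀ : Fin (d + 1) → K) : ℕ → Matrix (Fin (d + 1)) (Fin (d + 1)) ℤ
  | 0 => 1
  | t + 1 =>
    match T.digitAt v₀ t with
    | none => convergent v₀ t
    | some j => convergent v₀ t * T.mat j

/-- Column `k` of the `t`-th convergent matrix: an integer vector `(q, p₁, …, p_d)`, the `k`-th
simultaneous approximation at time `t` (coordinate `0` is the denominator `q`).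
[cite: Lagarias1993, §2] -/
noncomputable def approximant (v₀ : Fin (d + 1) → K) (t : ℕ) (k : Fin (d + 1)) : Fin (d + 1) → ℤ :=
  fun i => T.convergent v₀ t i k

/-- `orbit v₀ 0 = v₀`. [folklore] -/
@[simp] theorem orbit_zero (v₀ : Fin (d + 1) → K) : T.orbit v₀ 0 = v₀ := rfl

/-- `orbit v₀ (t+1) = next (orbit v₀ t)`. [folklore] -/
theorem orbit_succ (v₀ : Fin (d + 1) → K) (t : ℕ) : T.orbit v₀ (t + 1) = T.next (T.orbit v₀ t) := rfl

/-- `convergent v₀ 0 = 1`. [folklore] -/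
@[simp] theorem convergent_zero (v₀ : Fin (d + 1) → K) : T.convergent v₀ 0 = 1 := rfl

/-- After a terminated step the orbit does not move. [folklore] -/
theorem orbit_succ_of_digitAt_eq_none {v₀ : Fin (d + 1) → K} {t : ℕ} (h : T.digitAt v₀ t = none) :
    T.orbit v₀ (t + 1) = T.orbit v₀ t := by
  rw [orbit_succ, next]
  unfold digitAt at h
  split
  · rfl
  · simp_all

/-- A live step moves the orbit by `A_j⁻¹`. [cite: Thuswaldner2020, Definition 3.4.3] -/
theorem orbit_succ_of_digitAt_eq_some {v₀ : Fin (d + 1) → K} {t : ℕ} {j : ι}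
    (h : T.digitAt v₀ t = some j) : T.orbit v₀ (t + 1) = act (T.inv j) (T.orbit v₀ t) := by
  rw [orbit_succ, next]
  unfold digitAt at h
  split
  · simp_all
  · simp_all

/-- After a terminated step the convergent matrix does not change. [folklore] -/
theorem convergent_succ_of_digitAt_eq_none {v₀ : Fin (d + 1) → K} {t : ℕ}
    (h : T.digitAt v₀ t = none) : T.convergent v₀ (t + 1) = T.convergent v₀ t := by
  simp only [convergent]
  split <;> simp_all

/-- A live step multiplies the convergent matrix by `A_j` on the right. [cite: Lagarias1993, §2] -/
theorem convergent_succ_of_digitAt_eq_some {v₀ : Fin (d + 1) → K} {t : ℕ} {j : ι}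
    (h : T.digitAt v₀ t = some j) : T.convergent v₀ (t + 1) = T.convergent v₀ t * T.mat j := by
  simp only [convergent]
  split <;> simp_all

/-- Termination is permanent (one step). [folklore] -/
theorem terminated_succ {v₀ : Fin (d + 1) → K} {t : ℕ} (h : T.Terminated v₀ t) :
    T.Terminated v₀ (t + 1) := by
  unfold Terminated at *
  unfold digitAt
  rw [T.orbit_succ_of_digitAt_eq_none h]
  exact h

/-- Termination is permanent. [folklore] -/
theorem Terminated.of_le {T : MCFAlgorithm d ι} {v₀ : Fin (d + 1) → K} {t s : ℕ}
    (h : T.Terminated v₀ t) (hts : t ≤ s) : T.Terminated v₀ s := by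
  induction s, hts using Nat.le_induction with
  | base => exact h
  | succ s _ ih => exact T.terminated_succ ih

/-- **Fundamental relation** `v₀ = P_t v_t`: the starting vector is the image of the current
vector under the current convergent matrix; in particular `v₀` lies in the cone spanned by
the columns of `P_t` whenever `v_t ≥ 0`. [cite: Lagarias1993, §2] -/
theorem act_convergent_orbit (v₀ : Fin (d + 1) → K) (t : ℕ) :
    act (T.convergent v₀ t) (T.orbit v₀ t) = v₀ := by
  induction t with
  | zero => simp
  | succ t ih =>
    cases h : T.digitAt v₀ t with
    | none =>
      rw [T.convergent_succ_of_digitAt_eq_none h, T.orbit_succ_of_digitAt_eq_none h, ih]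
    | some j =>
      rw [T.convergent_succ_of_digitAt_eq_some h, T.orbit_succ_of_digitAt_eq_some h, act_act,
        Matrix.mul_assoc, mat_mul_inv, Matrix.mul_one, ih]

/-- The convergent matrices are unimodular. [cite: Lagarias1993, §2] -/
theorem isUnit_det_convergent (v₀ : Fin (d + 1) → K) (t : ℕ) :
    IsUnit (T.convergent v₀ t).det := by
  induction t with
  | zero => simp
  | succ t ih =>
    cases h : T.digitAt v₀ t with
    | none => rw [T.convergent_succ_of_digitAt_eq_none h]; exact ih
    | some j =>
      rw [T.convergent_succ_of_digitAt_eq_some h, Matrix.det_mul]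
      exact ih.mul (T.isUnit_det j)

end Dynamics

section Transducer

/-! ### Finite-state post-processing of the digit stream

A deterministic transducer (Mealy machine) is given by a state type `σ` (finite in
applications: `[Finite σ]`), an initial state and a step function `σ → ι → σ × List Γ`
returning the new state and the emitted word; these are exactly the fields `init`, `step` of
`Literature.Computability.Complexity.FST` (Hopcroft–Ullman 1979, §2.7), which can be plugged
in here without importing the Turing-machine development. -/

variable {K : Type*} [CommRing K] [LinearOrder K] {σ Γ : Type*}

/-- The state of the transducer after reading the digits `j(0), …, j(t-1)` of the expansion of
`v₀` (terminated steps read nothing). [folklore] -/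
noncomputable def transducerState (step : σ → ι → σ × List Γ) (s₀ : σ) (v₀ : Fin (d + 1) → K) :
    ℕ → σ
  | 0 => s₀
  | t + 1 =>
    match T.digitAt v₀ t with
    | none => transducerState step s₀ v₀ t
    | some j => (step (transducerState step s₀ v₀ t) j).1

/-- The word emitted by the transducer while reading the digit `j(t)` (empty after
termination). [folklore] -/
noncomputable def transducerOutput (step : σ → ι → σ × List Γ) (s₀ : σ) (v₀ : Fin (d + 1) → K)
    (t : ℕ) : List Γ :=
  match T.digitAt v₀ t with
  | none => []
  | some j => (step (T.transducerState step s₀ v₀ t) j).2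

/-- The integer `z` is **emitted** along the expansion of `v₀`: at some time `t` the transducer,
reading `j(t)`, outputs a position `(k, l)` and the entry `(P_{t+1})_{k l}` of the then-current
convergent matrix `P_{t+1} = A_{j(0)} ⋯ A_{j(t)}` equals `z`. (Vocabulary for the finite-memory
rung of route PneNP/DirichletPigeons.) [folklore] -/
def EmitsEntry (step : σ → ι → σ × List (Fin (d + 1) × Fin (d + 1))) (s₀ : σ)
    (v₀ : Fin (d + 1) → K) (z : ℤ) : Prop :=
  ∃ t : ℕ, ∃ kl ∈ T.transducerOutput step s₀ v₀ t, T.convergent v₀ (t + 1) kl.1 kl.2 = z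

/-- Nothing is emitted at a terminated step. [folklore] -/
theorem transducerOutput_of_terminated (step : σ → ι → σ × List Γ) (s₀ : σ) {v₀ : Fin (d + 1) → K}
    {t : ℕ} (h : T.Terminated v₀ t) : T.transducerOutput step s₀ v₀ t = [] := by
  unfold transducerOutput
  unfold Terminated at h
  split <;> simp_all

end Transducer

end MCFAlgorithm

end Literature.NumberTheory.DiophantineApproximation
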